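/-
Copyright (c) 2026 the pub-hodgecm-mathlib formalisation cell (harness21).  Track B «K2-LIT» prover seat hodgecm-mathlib-K2E3-p21 (g0), 2026-09-03: the WILD twin of ★ 56-B3(55-B)
FILE 1 `F0P3cStCharTSHorocyclesAtDatumRamified` §2 (the horocycle index of vertices ∕ edges) at a ramified CM place of ANY residue characteristic — rung 5 of the «★73-W» tower
(dealer K2E3-plan (g1) DEALS BATCH #1 ∕ SYNC 22:07:32Z; census K2/STATUS 22:06:26Z).
-/
import Summits.HodgeConjecture.HodgeConjecture.Theorems.F0P3cStCharTSHorocyclesAtDatumRamified  -- ★ 56-B3(55-B) FILE 1 (F0P3a-p06 (g26)): §1 `_of_involution` torus letters BY NAME (place-free); brings ★ B-1 (`mem_cmBorelTriple_{N,M,P}_iff`, `mapEdgeSet_actionHom_mul`), ★ R1, ★ B1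
import Literature.NumberTheory.Automorphic.UnitaryLatticeTreeHorosphereTransversalWild            -- ★ p855217 (this seat): (H5) ∕ (H6₂) ∕ (H7e) ∕ (H7!e) `_of_ramified` at a ramified quadratic datum of any residue characteristic
import HarnessLib

/-!
# «★73-W» tower, rung 5 — THE WILD TWIN of ★ 56-B3(55-B) FILE 1 §2 «HOROCYCLES AT THE DATUM»: the horocycle index of vertices ∕ edges of the `U(Φ₃)(L⁺_v)` tree at a ramified place of
# ANY residue characteristic (Bruhat–Tits 1972 §10; Serre, *Trees* II.1.1)

Cell `pub/hodgecm-mathlib` (D-0151), Track B «K2-LIT», crux H413 = `stmt-HodgeConjecture-24833`; lane `--kind proof --supports stmt-HodgeConjecture-24833 --as helper` (THEOREMS ONLY: no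
definition ∕ instance ∕ notation ∕ named fact ∕ `sorry`; count-neutral).  Namespace `Summit.HodgeConjecture.HodgeConjecture.Cruxes.H413.K2E3WildHorocyclesAtDatum`.
★ `F0P3cStCharTSHorocyclesAtDatumRamified` §1 (`…_of_involution`: the torus translation `τ`, `eA τ = diag(ϖ, 1, (σ_w ϖ)⁻¹)`, and its two corollaries) is PLACE-FREE already and is used BY
NAME; its §2 (the horocycle-index heads (X1v)∕(X1e)) reads the TAME letters `(hσϖ : σ_w ϖ = −ϖ) (hres) (h2 : |2|_w = 1) (hnorm)` through (T-II) ★ `…HorosphereTransversalRamified`.  This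
file re-issues §2 with those four letters replaced IN THEIR SLOT by the RAMIFIED-DATUM letters `(heven) {d t} (hd : |ϖ − σ_w ϖ| = |ϖ|^d) (h1d) (h2t : |2|_w = |ϖ|^t)` (the conjuncts of Track A's
`IsRamifiedQuadraticDatum σ_w ϖ d t`, available at EVERY ramified CM place and ANY uniformiser by ★ `F0P3cDyRamWildPlaceDatum.exists_isRamifiedQuadraticDatum_of_placesOver`), the (T-II)
calls replaced by ★ p855217 (T-II-W) `…_of_ramified`; every other binder and both conclusions VERBATIM; proofs = ★'s token for token.
HONEST LABEL: count-neutral datum helper of the WILD road (K2E3-p21's census: 18 Summits-side re-letterings between ★ p854998 and «★73-W»); h413 OPEN; HC_CM is proved only modulo the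
7 printed citations (2 remaining named inputs hLiu418 = stmt-HodgeConjecture-24832, h413 = stmt-HodgeConjecture-24833) until rung 0 closes; nothing printed is asserted here.

* §1 `exists_horocycleIndex_vertices_of_ramified` ((X1v)), `exists_horocycleIndex_edges_of_ramified` ((X1e)).

## References
* [BruhatTits1972] F. Bruhat, J. Tits, *Groupes réductifs sur un corps local I*, Publ. Math. IHÉS 41 (1972), §10.
* [Serre1980Trees] J.-P. Serre, *Trees* (1980), Ch. II §1.1, Ch. I §6.4.
* [Rogawski1990] J. D. Rogawski, *Automorphic Representations of Unitary Groups in Three Variables*, Ann. of Math. Stud. 123 (1990), §1.10 p. 9, §4.5 p. 45.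
* [Tits1979] J. Tits, *Reductive groups over local fields*, PSPM 33.1 (1979), §2.7 (p. 48), §2.10 (p. 49).
-/

set_option autoImplicit false
-- the mandated namespace has the single-problem summit's repeated segment (`HodgeConjecture.HodgeConjecture`)
set_option linter.dupNamespace false

noncomputable section

open NumberField IsDedekindDomain
open scoped Valued WithZero Matrix MatrixGroups
open Literature.NumberTheory.Rogawski1990 Literature.NumberTheory.Automorphic Literature.NumberTheory.Automorphic.UnitaryGroup
open Literature.NumberTheory.Automorphic.UnitaryLatticeTree Literature.NumberTheory.Automorphic.HermitianLattice

namespace Summit.HodgeConjecture.HodgeConjecture.Cruxes.H413.K2E3WildHorocyclesAtDatum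

open Summit.HodgeConjecture.HodgeConjecture.Cruxes.H413.F0P3cStCharTSHorocyclesAtDatum
open Summit.HodgeConjecture.HodgeConjecture.Cruxes.H413.F0P3cStCharTSHorocyclesAtDatumRamified

/-! ## §1 THE HOROCYCLE INDEX AT THE DATUM at a ramified place of ANY residue characteristic (`_of_ramified`: the datum letters `heven hd h1d h2t`) -/

section Horocycle

variable (L : Type) [Field L] [NumberField L] [IsCMField L] (v : HeightOneSpectrum (𝓞 ↥(maximalRealSubfield L)))
  (w : PlacesOver L v) (hw : IsCMField.complexConj L • w.1 = w.1) {ϖ : w.1.adicCompletion L}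
  (eA : Gqs L v ≃ₜ* ↥(unitaryGroupOfForm (galAdicCompletionMap (L := L) (IsCMField.complexConj L) hw) ((StdForm.antidiagonal 3).over (w.1.adicCompletion L))))
  (heA : ∀ g : Gqs L v,
    ((eA g : ↥(unitaryGroupOfForm (galAdicCompletionMap (L := L) (IsCMField.complexConj L) hw) ((StdForm.antidiagonal 3).over (w.1.adicCompletion L)))) :
        GL (Fin 3) (w.1.adicCompletion L)) =
      ((localNonsplitEquiv (IsCMField.complexConj L) (qsForm L) (IsCMField.complexConj_ne_one L) w hw g :
        ↥(unitaryGroupOfForm (galAdicCompletionMap (L := L) (IsCMField.complexConj L) hw) (placeForm (qsForm L) w.1))) : GL (Fin 3) (w.1.adicCompletion L)))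
  {a : Gqs L v →* ((latticeGraph (galAdicCompletionMap (L := L) (IsCMField.complexConj L) hw) ϖ ((StdForm.antidiagonal 3).over (w.1.adicCompletion L))) ≃g
    (latticeGraph (galAdicCompletionMap (L := L) (IsCMField.complexConj L) hw) ϖ ((StdForm.antidiagonal 3).over (w.1.adicCompletion L))))}
  (ha : ∀ g, a g = latticeGraphIso (galAdicCompletionMap (L := L) (IsCMField.complexConj L) hw) ϖ ((StdForm.antidiagonal 3).over (w.1.adicCompletion L)) (eA g))
  (A : ℤ → {M : Submodule 𝒪[(w.1.adicCompletion L)] (Fin 3 → (w.1.adicCompletion L)) //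
    IsVertex (galAdicCompletionMap (L := L) (IsCMField.complexConj L) hw) ϖ ((StdForm.antidiagonal 3).over (w.1.adicCompletion L)) M})
  (hA0 : ∀ c : ℤ, (A (2 * c)).1 = latt (Matrix.diagonal ![ϖ ^ c, (1 : w.1.adicCompletion L), ϖ ^ (-c)]))
  (hA1 : ∀ c : ℤ, (A (2 * c + 1)).1 = latt (Matrix.diagonal ![ϖ ^ (c + 1), (1 : w.1.adicCompletion L), ϖ ^ (-c)]))

include heA ha hA0 hA1 in
/-- **(X1v) THE HOROCYCLE INDEX OF A VERTEX AT THE DATUM at a ramified place (tame or WILD)**: functions `idx : 𝓥 → ℤ`, `tr : 𝓥 → N(L⁺_v)` with `tr x · A (idx x) = x`, `idx` invariant under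
`N(L⁺_v)` and `idx (A j) = j` ((T-II-W) (H5)(H6₂) `_of_ramified` pulled back along `eA`).  Twin of ★ `exists_horocycleIndex_vertices`, conclusion VERBATIM. [cite: BruhatTits1972, §10]
[cite: Serre1980Trees, II.1.1] [cite: Rogawski1990, §4.5 p. 45] [cite: Tits1979, §2.4] -/
theorem exists_horocycleIndex_vertices_of_ramified
    (hσ : ∀ x, (galAdicCompletionMap (L := L) (IsCMField.complexConj L) hw) ((galAdicCompletionMap (L := L) (IsCMField.complexConj L) hw) x) = x)
    (hvσ : ∀ x, Valued.v ((galAdicCompletionMap (L := L) (IsCMField.complexConj L) hw) x) = Valued.v x) (hϖ : Valued.v ϖ = WithZero.exp (-1 : ℤ))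
    (heven : ∀ x : (w.1.adicCompletion L), (galAdicCompletionMap (L := L) (IsCMField.complexConj L) hw) x = x → x ≠ 0 → ∃ n : ℤ, Valued.v x = WithZero.exp (2 * n))
    {d t : ℕ} (hd : Valued.v (ϖ - (galAdicCompletionMap (L := L) (IsCMField.complexConj L) hw) ϖ) = Valued.v ϖ ^ d) (h1d : 1 ≤ d)
    (h2t : Valued.v (2 : (w.1.adicCompletion L)) = Valued.v ϖ ^ t)
    :
    ∃ (idx : {M : Submodule 𝒪[(w.1.adicCompletion L)] (Fin 3 → (w.1.adicCompletion L)) //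
        IsVertex (galAdicCompletionMap (L := L) (IsCMField.complexConj L) hw) ϖ ((StdForm.antidiagonal 3).over (w.1.adicCompletion L)) M} → ℤ)
      (tr : {M : Submodule 𝒪[(w.1.adicCompletion L)] (Fin 3 → (w.1.adicCompletion L)) //
        IsVertex (galAdicCompletionMap (L := L) (IsCMField.complexConj L) hw) ϖ ((StdForm.antidiagonal 3).over (w.1.adicCompletion L)) M} → Gqs L v),
      (∀ x, tr x ∈ (cmBorelTriple L 3 v : ParabolicTriple (Gqs L v)).N) ∧ (∀ x, a (tr x) (A (idx x)) = x) ∧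
      (∀ n ∈ (cmBorelTriple L 3 v : ParabolicTriple (Gqs L v)).N, ∀ x, idx (a n x) = idx x) ∧ (∀ j : ℤ, idx (A j) = j) := by
  have hex := fun x => exists_mem_unipotentU_latticeGraphIso_apartmentEnum_eq_of_ramified hσ hvσ hϖ heven hd h1d h2t A hA0 hA1 x
  choose n hn j hj using hex
  refine ⟨j, fun x => eA.symm (n x), fun x => ?_, fun x => ?_, fun g hg x => ?_, fun i => ?_⟩
  · rw [mem_cmBorelTriple_N_iff L v w hw eA heA, ContinuousMulEquiv.apply_symm_apply]; exact hn x
  · rw [ha, ContinuousMulEquiv.apply_symm_apply]; exact hj x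
  · have hg' := (mem_cmBorelTriple_N_iff L v w hw eA heA g).1 hg
    have h1 : latticeGraphIso (galAdicCompletionMap (L := L) (IsCMField.complexConj L) hw) ϖ ((StdForm.antidiagonal 3).over (w.1.adicCompletion L))
        (eA g * n x) (A (j x)) = a g x := by
      rw [latticeGraphIso_mul_apply, hj x, ha]
    exact eq_of_mem_unipotentU_of_latticeGraphIso_apartmentEnum_eq₂_of_ramified hσ hvσ hϖ heven hd h1d h2t A hA0 hA1 (hn (a g x)) (mul_mem hg' (hn x))
      ((hj (a g x)).trans h1.symm)
  · exact eq_of_mem_unipotentU_of_latticeGraphIso_apartmentEnum_eq₂_of_ramified hσ hvσ hϖ heven hd h1d h2t A hA0 hA1 (hn (A i)) (one_mem _)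
      ((hj (A i)).trans (latticeGraphIso_one_apply _).symm)

include heA ha hA0 hA1 in
set_option maxHeartbeats 1600000 in  -- statement-level `whnf` on the datum edge type `⟨s(A j, A (j+1)), _⟩` over the CM carriers (= ★ B-1's budget, measured there)
/-- **(X1e) THE HOROCYCLE INDEX OF AN EDGE AT THE DATUM at a ramified place (tame or WILD)**: `idx₁ : 𝓔 → ℤ`, `tr₁ : 𝓔 → N(L⁺_v)` with `tr₁ d · {A (idx₁ d), A (idx₁ d + 1)} = d`, `idx₁`
invariant under `N(L⁺_v)`, `idx₁ {A j, A (j+1)} = j` ((T-II-W) (H7e)(H7!e) `_of_ramified` along `eA`; edge certificates ★ B1 `…_succ_of_involution`, proof-irrelevant).  Twin of ★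
`exists_horocycleIndex_edges`, conclusion VERBATIM. [cite: BruhatTits1972, §10] [cite: Serre1980Trees, II.1.1] [cite: Tits1979, §2.4] -/
theorem exists_horocycleIndex_edges_of_ramified
    (hσ : ∀ x, (galAdicCompletionMap (L := L) (IsCMField.complexConj L) hw) ((galAdicCompletionMap (L := L) (IsCMField.complexConj L) hw) x) = x)
    (hvσ : ∀ x, Valued.v ((galAdicCompletionMap (L := L) (IsCMField.complexConj L) hw) x) = Valued.v x) (hϖ : Valued.v ϖ = WithZero.exp (-1 : ℤ))
    (heven : ∀ x : (w.1.adicCompletion L), (galAdicCompletionMap (L := L) (IsCMField.complexConj L) hw) x = x → x ≠ 0 → ∃ n : ℤ, Valued.v x = WithZero.exp (2 * n))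
    {d t : ℕ} (hd : Valued.v (ϖ - (galAdicCompletionMap (L := L) (IsCMField.complexConj L) hw) ϖ) = Valued.v ϖ ^ d) (h1d : 1 ≤ d)
    (h2t : Valued.v (2 : (w.1.adicCompletion L)) = Valued.v ϖ ^ t)
    :
    ∃ (idx₁ : (latticeGraph (galAdicCompletionMap (L := L) (IsCMField.complexConj L) hw) ϖ ((StdForm.antidiagonal 3).over (w.1.adicCompletion L))).edgeSet → ℤ)
      (tr₁ : (latticeGraph (galAdicCompletionMap (L := L) (IsCMField.complexConj L) hw) ϖ ((StdForm.antidiagonal 3).over (w.1.adicCompletion L))).edgeSet → Gqs L v),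
      (∀ d, tr₁ d ∈ (cmBorelTriple L 3 v : ParabolicTriple (Gqs L v)).N) ∧
      (∀ d, (a (tr₁ d)).mapEdgeSet ⟨s(A (idx₁ d), A (idx₁ d + 1)), (SimpleGraph.mem_edgeSet _).2 (latticeGraph_adj_apartmentEnum_succ_of_involution hσ hvσ hϖ A hA0 hA1 (idx₁ d))⟩ = d) ∧
      (∀ n ∈ (cmBorelTriple L 3 v : ParabolicTriple (Gqs L v)).N, ∀ d, idx₁ ((a n).mapEdgeSet d) = idx₁ d) ∧
      (∀ j : ℤ, idx₁ ⟨s(A j, A (j + 1)), (SimpleGraph.mem_edgeSet _).2 (latticeGraph_adj_apartmentEnum_succ_of_involution hσ hvσ hϖ A hA0 hA1 j)⟩ = j) := by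
  have hex := fun d => exists_mem_unipotentU_mapEdgeSet_apartmentEnum_eq_of_ramified hσ hvσ hϖ heven hd h1d h2t A hA0 hA1 d
  choose n hn j hj using hex
  refine ⟨j, fun d => eA.symm (n d), fun d => ?_, fun d => ?_, fun g hg d => ?_, fun i => ?_⟩
  · rw [mem_cmBorelTriple_N_iff L v w hw eA heA, ContinuousMulEquiv.apply_symm_apply]; exact hn d
  · rw [ha, ContinuousMulEquiv.apply_symm_apply]; exact hj d
  · have hg' := (mem_cmBorelTriple_N_iff L v w hw eA heA g).1 hg
    have h1 : (latticeGraphIso (galAdicCompletionMap (L := L) (IsCMField.complexConj L) hw) ϖ ((StdForm.antidiagonal 3).over (w.1.adicCompletion L))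
        (eA g * n d)).mapEdgeSet ⟨s(A (j d), A (j d + 1)), (SimpleGraph.mem_edgeSet _).2 (latticeGraph_adj_apartmentEnum_succ_of_involution hσ hvσ hϖ A hA0 hA1 (j d))⟩ = (a g).mapEdgeSet d := by
      rw [← ContinuousMulEquiv.apply_symm_apply eA (n d), ← map_mul, ← ha, mapEdgeSet_actionHom_mul L v w hw eA ha, ha (eA.symm (n d)),
        ContinuousMulEquiv.apply_symm_apply, hj d]
    exact eq_of_mem_unipotentU_of_mapEdgeSet_apartmentEnum_eq_of_ramified hσ hvσ hϖ heven hd h1d h2t A hA0 hA1 (hn ((a g).mapEdgeSet d)) (mul_mem hg' (hn d))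
      ((hj ((a g).mapEdgeSet d)).trans h1.symm)
  · refine eq_of_mem_unipotentU_of_mapEdgeSet_apartmentEnum_eq_of_ramified hσ hvσ hϖ heven hd h1d h2t A hA0 hA1 (hn _) (one_mem _) ((hj _).trans ?_)
    apply Subtype.ext
    change _ = Sym2.map (latticeGraphIso (galAdicCompletionMap (L := L) (IsCMField.complexConj L) hw) ϖ ((StdForm.antidiagonal 3).over (w.1.adicCompletion L)) 1) s(A i, A (i + 1))
    rw [Sym2.map_mk, latticeGraphIso_one_apply, latticeGraphIso_one_apply]

end Horocycle


end Summit.HodgeConjecture.HodgeConjecture.Cruxes.H413.K2E3WildHorocyclesAtDatum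

end
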